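import Summits.AtomisticToContinuum.HydrodynamicLimit.Theses.AdiabaticParcels
import Summits.AtomisticToContinuum.HydrodynamicLimit.Theorems.DensityCap.Negative.Equilibrium
import Summits.AtomisticToContinuum.HydrodynamicLimit.Theorems.DenseExcursion.Negative.Untied

/-!
# Negative knowledge for the crux `AdiabaticParcels.DensityLimit` (stmt-AtomisticToContinuum-17799) — load-bearing analysis

From the vetting pass refuter-rattack-stmt-AtomisticToContinuum-17799-0 (crux-attack, 2026-08-17).  Nothing here
asserts the crux; every theorem is sorry-free over landed tree facts.

* `hypotheses_inhabited` — NON-VACUITY at every level: for every `η₀ > 0` (whatever packing threshold a proof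
  picks), the constant profiles `(a₀, u₀, θ₀) = (1, 0, 1)` and every `σ₀ > 0`, there is `0 < σ < σ₀` at which the
  inner hypothesis block of the crux is inhabited with `T = 1 > 0` (constant classical hs-Euler state
  `DenseExcursionUntied.isHardSphereEulerSolution_const`, guard `σ³ < η₀`, flows by Alexander
  `PolynomialCompressionPDE.flows_nonempty`, probability laws and `t = 0` LLN by `DensityCapNegative.homogeneous_lln`).
* `conclusion_at_equilibrium` — a GENUINE MODEL where the crux's conclusion holds non-trivially: at global
  equilibrium the density field converges at EVERY time (`DensityCapNegative.tendstoHydroFieldsAt_homogeneous`,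
  flow invariance of the homogeneous Gibbs law) — no constant-profile instance can refute the crux.
* `DensityLimitWithoutLLN0` / `densityLimit_false_without_lln0` — the `t = 0` convergence hypothesis is
  LOAD-BEARING: with it deleted the statement is false (constant profiles, the guarded constant Euler state of
  density `2`, `χ ≡ 1`, `δ = 1/2`: the empirical density of `1` is identically `1 ≠ 2 = ∫ 1·2`).
Recorded in the seat's evidence file `DensityLimitVetting.lean` but not landed here (positive conclusions):
`_root_.HydrodynamicLimit → DensityLimit` (S → C, pure logic) and `DensityLimit ↔` (the same statement without the
clause `∀ N, IsProbabilityMeasure (localGibbsLaw …)`, dischargeable for `σ ≤ 1/2` by `isProbabilityMeasure_localGibbsLaw`).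
-/

noncomputable section

open MeasureTheory Filter Set Topology
open scoped ENNReal
open Literature.MathematicalPhysics.KineticTheory Literature.Analysis.FluidPDE
open Summit.AtomisticToContinuum.HydrodynamicLimit.Theses.AdiabaticParcels

namespace Summit.AtomisticToContinuum.HydrodynamicLimit.Theorems.DensityLimitNegative

/-- A positive `σ` below four thresholds at once. -/
theorem small_sigma (σ₀ σ₁ η₀ : ℝ) (hσ₀ : 0 < σ₀) (hσ₁ : 0 < σ₁) (hη₀ : 0 < η₀) :
    ∃ σ : ℝ, 0 < σ ∧ σ < σ₀ ∧ σ < σ₁ ∧ σ < 1 / 2 ∧ 2 * σ ^ 3 < η₀ := by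
  refine ⟨min (min (σ₀ / 2) (σ₁ / 2)) (min (1 / 4) (η₀ / 4)), ?_, ?_, ?_, ?_, ?_⟩
  · exact lt_min (lt_min (by positivity) (by positivity)) (lt_min (by norm_num) (by positivity))
  · exact (min_le_left _ _).trans_lt ((min_le_left _ _).trans_lt (by linarith))
  · exact (min_le_left _ _).trans_lt ((min_le_right _ _).trans_lt (by linarith))
  · exact (min_le_right _ _).trans_lt ((min_le_left _ _).trans_lt (by norm_num))
  · set s := min (min (σ₀ / 2) (σ₁ / 2)) (min (1 / 4) (η₀ / 4)) with hs
    have hs0 : 0 < s := lt_min (lt_min (by positivity) (by positivity)) (lt_min (by norm_num) (by positivity))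
    have hs1 : s ≤ 1 / 4 := (min_le_right _ _).trans (min_le_left _ _)
    have hsη : s ≤ η₀ / 4 := (min_le_right _ _).trans (min_le_right _ _)
    have hcube : s ^ 3 ≤ s := by
      have h1 : s ≤ 1 := hs1.trans (by norm_num)
      calc s ^ 3 = s * (s * s) := by ring
        _ ≤ s * (1 * 1) := by
          apply mul_le_mul_of_nonneg_left _ hs0.le
          exact mul_le_mul h1 h1 hs0.le zero_le_one
        _ = s := by ring
    linarith

/-- **Non-vacuity at every level.** For every `η₀ > 0` (whatever threshold a proof picks), the constant profiles
`(a₀, u₀, θ₀) = (1, 0, 1)` and every `σ₀ > 0`, there is `0 < σ < σ₀` at which the inner hypothesis block of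
`DensityLimit` is inhabited with `T = 1 > 0`: the constant classical hs-Euler state `(1, 0, 1)` obeys the guard,
flows exist, the local Gibbs laws are probability measures and their `t = 0` fields converge. -/
theorem hypotheses_inhabited (η₀ : ℝ) (hη₀ : 0 < η₀) (σ₀ : ℝ) (hσ₀ : 0 < σ₀) :
    ∃ σ : ℝ, 0 < σ ∧ σ < σ₀ ∧ ∃ (T : ℝ) (ρ θ : ℝ → T3 → ℝ) (u : ℝ → T3 → V3),
      IsHardSphereEulerSolution σ T ρ u θ ∧ (∀ t ∈ Ico 0 T, ∀ x, ρ t x * σ ^ 3 < η₀) ∧ (0 : ℝ) ∈ Ico 0 T ∧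
      ∃ Φ : (N : ℕ) → HardSphereFlow (Torus.geometry (Fin 3)) (hsDiameter σ N) (N + 1),
        (∀ N, IsProbabilityMeasure (localGibbsLaw σ (fun _ => 1) (fun _ => 0) (fun _ => 1) N (Φ N))) ∧
        TendstoHydroFieldsAt (fun N => localGibbsLaw σ (fun _ => 1) (fun _ => 0) (fun _ => 1) N (Φ N))
          Φ ρ u θ 0 := by
  obtain ⟨σ₁, hσ₁, _, H⟩ := DensityCapNegative.homogeneous_lln
  obtain ⟨σ, hσ, hσσ₀, hσσ₁, hσ2, hσcube⟩ := small_sigma σ₀ σ₁ η₀ hσ₀ hσ₁ hη₀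
  obtain ⟨Φ⟩ := PolynomialCompressionPDE.flows_nonempty hσ hσ2
  refine ⟨σ, hσ, hσσ₀, 1, fun _ _ => 1, fun _ _ => 1, fun _ _ => 0,
    DenseExcursionUntied.isHardSphereEulerSolution_const σ 1 (0 : V3) one_pos one_pos, ?_, ⟨le_rfl, one_pos⟩,
    Φ, (H σ hσ hσσ₁ Φ).1, (H σ hσ hσσ₁ Φ).2⟩
  intro t _ x
  have : σ ^ 3 ≤ 2 * σ ^ 3 := by nlinarith [pow_pos hσ 3]
  linarith

/-- **A genuine model where the conclusion holds non-trivially.** At global equilibrium (profiles `(1,0,1)`) the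
density field of the crux converges at EVERY time `t`, through every flow family, for all small `σ`
(flow invariance of the homogeneous Gibbs law; tree theorem `tendstoHydroFieldsAt_homogeneous`). -/
theorem conclusion_at_equilibrium :
    ∃ σ₁ : ℝ, 0 < σ₁ ∧ ∀ σ : ℝ, 0 < σ → σ < σ₁ →
      ∀ Φ : (N : ℕ) → HardSphereFlow (Torus.geometry (Fin 3)) (hsDiameter σ N) (N + 1), ∀ t : ℝ,
        ∀ χ : T3 → ℝ, Continuous χ → ∀ δ : ℝ, 0 < δ →
          Tendsto (fun N => localGibbsLaw σ (fun _ => 1) (fun _ => 0) (fun _ => 1) N (Φ N)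
            {z | δ < |empiricalDensityField ((Φ N).flow t z) χ - ∫ x, χ x * (1 : ℝ)|}) atTop (𝓝 0) := by
  obtain ⟨σ₁, hσ₁, _, H⟩ := DensityCapNegative.tendstoHydroFieldsAt_homogeneous
  exact ⟨σ₁, hσ₁, fun σ hσ hσ1 Φ t χ hχ δ hδ => (H σ hσ hσ1 Φ t χ hχ δ hδ).1⟩

/-- The crux with the `t = 0` convergence hypothesis DELETED (all else verbatim). -/
def DensityLimitWithoutLLN0 : Prop :=
  ∃ η₀ : ℝ, 0 < η₀ ∧ ∀ (a₀ θ₀ : T3 → ℝ) (u₀ : T3 → V3), Continuous a₀ → Continuous θ₀ → Continuous u₀ →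
    (∀ x, 0 < a₀ x) → (∀ x, 0 < θ₀ x) → ∃ σ₀ : ℝ, 0 < σ₀ ∧ ∀ σ : ℝ, 0 < σ → σ < σ₀ →
      ∀ (T : ℝ) (ρ θ : ℝ → T3 → ℝ) (u : ℝ → T3 → V3), IsHardSphereEulerSolution σ T ρ u θ →
        (∀ t ∈ Ico 0 T, ∀ x, ρ t x * σ ^ 3 < η₀) →
        ∀ Φ : (N : ℕ) → HardSphereFlow (Torus.geometry (Fin 3)) (hsDiameter σ N) (N + 1),
          (∀ N, IsProbabilityMeasure (localGibbsLaw σ a₀ u₀ θ₀ N (Φ N))) →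
          ∀ t ∈ Ico 0 T, ∀ χ : T3 → ℝ, Continuous χ → ∀ δ : ℝ, 0 < δ →
            Tendsto (fun N => localGibbsLaw σ a₀ u₀ θ₀ N (Φ N)
              {z | δ < |empiricalDensityField ((Φ N).flow t z) χ - ∫ x, χ x * ρ t x|}) atTop (𝓝 0)

/-- **The `t = 0` tie is load-bearing**: without it the statement is false — the constant Euler state of density
`2` is guarded and classical, but the empirical density of `χ ≡ 1` is identically `1 ≠ 2`. -/
theorem densityLimit_false_without_lln0 : ¬ DensityLimitWithoutLLN0 := by
  rintro ⟨η₀, hη₀, H⟩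
  obtain ⟨σ₀, hσ₀, Hσ⟩ := H (fun _ => 1) (fun _ => 1) (fun _ => 0) continuous_const continuous_const
    continuous_const (fun _ => one_pos) (fun _ => one_pos)
  obtain ⟨σ, hσ, hσσ₀, -, hσ2, hσcube⟩ := small_sigma σ₀ 1 η₀ hσ₀ one_pos hη₀
  obtain ⟨Φ⟩ := PolynomialCompressionPDE.flows_nonempty hσ hσ2
  have hP : ∀ N, IsProbabilityMeasure (localGibbsLaw σ (fun _ => 1) (fun _ => 0) (fun _ => 1) N (Φ N)) :=
    fun N => isProbabilityMeasure_localGibbsLaw continuous_const continuous_const continuous_const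
      (fun _ => one_pos) (fun _ => one_pos) hσ2.le N (Φ N)
  have key := Hσ σ hσ hσσ₀ 1 (fun _ _ => 2) (fun _ _ => 1) (fun _ _ => 0)
    (DenseExcursionUntied.isHardSphereEulerSolution_const σ 1 (0 : V3) two_pos one_pos)
    (fun t _ x => by linarith) Φ hP 0 ⟨le_rfl, one_pos⟩ (fun _ => 1) continuous_const (1 / 2) one_half_pos
  -- the deviation event is everything: the empirical density of `1` is `1`, the target is `2`
  have hset : ∀ N, {z : Config (N + 1) (Fin 3) T3 |
      (1 / 2 : ℝ) < |empiricalDensityField ((Φ N).flow 0 z) (fun _ => (1 : ℝ)) - ∫ x : T3, (1 : ℝ) * 2|} = univ := by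
    intro N
    refine eq_univ_of_forall fun z => ?_
    simp only [mem_setOf_eq, empiricalDensityField_one (Nat.succ_ne_zero N)]
    have hint : ∫ _ : T3, (1 : ℝ) * 2 = 2 := by simp
    rw [hint]
    norm_num
  have key' : Tendsto (fun _ : ℕ => (1 : ℝ≥0∞)) atTop (𝓝 0) := by
    refine key.congr' (Eventually.of_forall fun N => ?_)
    simp only [hset N, measure_univ]
  exact zero_ne_one (tendsto_nhds_unique key' tendsto_const_nhds)

end Summit.AtomisticToContinuum.HydrodynamicLimit.Theorems.DensityLimitNegative

end
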